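/-
Copyright (c) 2026 The HCML crux team. All rights reserved.
Released under Apache 2.0 license as described in the file LICENSE.
Authors: K2E5-p17 (g4) (explicit-unit `hodgecm-mathlib-K2E5-p17-g4`)
-/
import Summits.HodgeConjecture.HodgeConjecture.Theorems.K2E3CuspFormCancellationPolychotomy   -- ★ (A) p858093 (this seat): the polychotomy and `cuspForm_cancellation_polychotomy_conjLevel`
import Summits.HodgeConjecture.HodgeConjecture.Theorems.K2E3CuspFormCancellationLevelOne      -- ★ (T20-e1′) `setIntegral_conj_comm`, `mem_inf_map_conj_iff`, `isOpen_inf_map_conj`, averaging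
import HarnessLib

/-!
# K2_E3 road (h413), U12 «Characters» — Theorem 20 in higher rank, abstract part (A′): TRANSPORT of the contracting directions under a family of
# conjugations (the Weyl chambers), and the LEVEL-ONE upgrade `∫_{K₁} f(x k y) dk = 0` from the conjugate level

Cell `pub/hodgecm-mathlib` (D-0151), Track B, seat K2E5-p17 (g4); line lead K2E3-p23 (g5) (RULINGS #12 (M12-3) «=»), co-owner of T20-GL₃ K2E3-p21 (g5) ((B-Iw)
`K2E3GLnCongruenceIwahoriTriple`), dealer K2E3-plan (g3).  `--supports stmt-HodgeConjecture-24833 --as helper`; THEOREMS ONLY (no definition ∕ instance ∕ notation ∕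
named fact ∕ `sorry`); never imports `Cruxes/…/Lines`.  COUNT-NEUTRAL.  Consumer: FILE (C) `K2E3GL3CuspFormCancellation` (Theorem 20 for `GL₃(F)`).

WHY.  ★ (A) `cuspForm_cancellation_polychotomy_conjLevel` takes ONE family `c ↦ (T_c, U_c, V_c, P_c, D_c)` of Iwahori triples, pieces and Levi defects.  At `GL₃(F)` the
natural family is «three regimes in the DOMINANT chamber» (Borel pair; the two maximal-parabolic pairs with a Levi defect) — [HarishChandra1970, VII §8] works with
`a ∈ A_F^+` — and the other five chambers are obtained by conjugating everything by a permutation matrix `w ∈ GL₃(𝒪)`, which normalises the level `K₀ = K_m`, every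
height ball `Ω k = 𝔅_k`, every deep level `L j = K_j` and the torus `A`.  §1–§3 prove, for an abstract group, that each of the six structural hypotheses of ★ (A)
(`hIw`, `h54`, `hV`, `hT`, `hnormU`, `hcontr`) passes from the base datum `(T, U, V, P, D)` to the conjugated datum
`(wTw⁻¹, wUw⁻¹, wVw⁻¹, {a : w⁻¹aw ∈ P}, D)` under exactly these invariances, that closedness of `U` and the cusp-form property transport (the latter in the HONEST
form `∫_U f(x · w u w⁻¹) du = 0` — a one-sided cusp form along `U` is NOT formally one along `wUw⁻¹`; at `GL₃` this is the cusp property of the slice of the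
`w`-conjugate torus element, ★ B4-E1∕B4-A1), and §3 packages ★ (A) over the index `W × ι` («chamber × regime») with base-indexed hypotheses and the cover in the
form `a ∉ Ω R ⇒ ∃ ω c, (w ω)⁻¹ a (w ω) ∈ P_c`.  §4 is the generic upgrade [HarishChandra1970, VII §3 p. 71] from the conjugate level `K₀(y⁻¹) = K₀ ∩ y⁻¹K₀y` to ANY
compact open level `K₁ ⊇ K₀`, `K₁ ⊆ Ω 0`, stated once and for all with the conjugate-level vanishing as a HYPOTHESIS (so it serves ★ (A), this file, and the rank-one ★
Core alike): `(∀ x ∉ Ω R, ∫_{K₀(y⁻¹)} f(x y k) dk = 0) ⇒ ∀ x ∉ Ω R, ∫_{K₁} f(x k y) dk = 0` for `μ` left and right invariant.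
* §1 `mem_of_mem_map_conj`, `conj_mem_map_conj` (membership in `wSw⁻¹`; the `iff` is ★ `Subgroup.mem_map_equiv`); the six transports `iwahori_map_conj`, `lemma54_map_conj`, `conjV_map_conj`, `conjT_map_conj`, `normU_map_conj`,
  `contr_map_conj`.
* §2 `isClosed_map_conj`; `integral_map_conj_eq_zero_of_forall_haar` (cusp transport along the conjugation isomorphism `U ≃ₜ* wUw⁻¹`, one-sided, honest form).
* §3 **`cuspForm_cancellation_polychotomy_conjLevel_of_base`** — ★ (A) for the transported family `W × ι`: `∫_{k ∈ K′} f(x y k) dμ = 0` for `y ∈ Ω s`, `x ∉ Ω (m_C + R + s)`.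
* §4 **`setIntegral_level_eq_zero_of_conjLevel`** (the `K₀(y⁻¹) ↝ K₁` upgrade, print p. 71) and **`cuspForm_cancellation_polychotomy_levelOne_of_base`** (§3 ∘ §4).
[HarishChandra1970, Part VII §2 Thm. 20 p. 70, §3 p. 71, §8 pp. 80–84]; [Casselman1995, Prop. 1.4.3–1.4.4]; [Folland1995, §2.4].

HONEST LABEL: HC_CM is proved only modulo the 7 printed citations (2 remaining named inputs: hLiu418 = stmt-HodgeConjecture-24832, h413 = stmt-HodgeConjecture-24833)
until rung 0 closes; count-neutral helper (abstract bookkeeping; nothing printed is asserted).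
-/

set_option autoImplicit false
set_option linter.dupNamespace false   -- `Summit.HodgeConjecture.HodgeConjecture.…` (D-0017 nested layout; lakefile exemption for Summits)

noncomputable section

open MeasureTheory MeasureTheory.Measure Topology Set
open scoped Pointwise ENNReal
open Summit.HodgeConjecture.HodgeConjecture.Cruxes.H413.K2E3CuspFormCancellationPolychotomy
open Summit.HodgeConjecture.HodgeConjecture.Cruxes.H413.K2E3CuspFormCancellationLevelOne

namespace Summit.HodgeConjecture.HodgeConjecture.Cruxes.H413.K2E3CuspFormCancellationPolychotomyTransport

/-! ## §1 Transport of the six structural hypotheses under a conjugation -/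

section Algebra

variable {G : Type*} [Group G]

/-- `x ∈ S ⇒ w x w⁻¹ ∈ w S w⁻¹`. [folklore] -/
theorem conj_mem_map_conj (S : Subgroup G) (w : G) {x : G} (hx : x ∈ S) : w * x * w⁻¹ ∈ S.map (MulAut.conj w).toMonoidHom := by
  rw [Subgroup.mem_map_equiv, MulAut.conj_symm_apply]
  have e : w⁻¹ * (w * x * w⁻¹) * w = x := by group
  rwa [e]

/-- `x ∈ w S w⁻¹ ⇒ w⁻¹ x w ∈ S`. [folklore] -/
theorem mem_of_mem_map_conj (S : Subgroup G) (w : G) {x : G} (hx : x ∈ S.map (MulAut.conj w).toMonoidHom) : w⁻¹ * x * w ∈ S := by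
  rw [Subgroup.mem_map_equiv, MulAut.conj_symm_apply] at hx
  exact hx

/-- `x ∈ K₀ ⊓ w S w⁻¹ ↔ (x ∈ K₀ ∧ w⁻¹ x w ∈ S)`. [folklore] -/
theorem mem_inf_map_conj_iff' (K₀ S : Subgroup G) (w x : G) : x ∈ K₀ ⊓ S.map (MulAut.conj w).toMonoidHom ↔ x ∈ K₀ ∧ w⁻¹ * x * w ∈ S := by
  rw [Subgroup.mem_inf, Subgroup.mem_map_equiv, MulAut.conj_symm_apply]

/-- **TRANSPORT OF THE IWAHORI ORDER `hIw`**: if `K₀ = (K₀ ∩ V)(K₀ ∩ T)(K₀ ∩ U)` and `w` normalises `K₀`, then `K₀ = (K₀ ∩ wVw⁻¹)(K₀ ∩ wTw⁻¹)(K₀ ∩ wUw⁻¹)`.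
[cite: Casselman1995, Prop. 1.4.4] [cite: HarishChandra1970, Part VII §8 p. 81] -/
theorem iwahori_map_conj (K₀ T U V : Subgroup G) (w : G) (hw : ∀ k ∈ K₀, w * k * w⁻¹ ∈ K₀) (hw' : ∀ k ∈ K₀, w⁻¹ * k * w ∈ K₀)
    (hIw : ∀ k ∈ K₀, ∃ v ∈ K₀ ⊓ V, ∃ t ∈ K₀ ⊓ T, ∃ u ∈ K₀ ⊓ U, k = v * t * u) :
    ∀ k ∈ K₀, ∃ v ∈ K₀ ⊓ V.map (MulAut.conj w).toMonoidHom, ∃ t ∈ K₀ ⊓ T.map (MulAut.conj w).toMonoidHom,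
      ∃ u ∈ K₀ ⊓ U.map (MulAut.conj w).toMonoidHom, k = v * t * u := by
  intro k hk
  obtain ⟨v, hv, t, ht, u, hu, hvtu⟩ := hIw (w⁻¹ * k * w) (hw' k hk)
  refine ⟨w * v * w⁻¹, Subgroup.mem_inf.2 ⟨hw v (Subgroup.mem_inf.1 hv).1, conj_mem_map_conj V w (Subgroup.mem_inf.1 hv).2⟩,
    w * t * w⁻¹, Subgroup.mem_inf.2 ⟨hw t (Subgroup.mem_inf.1 ht).1, conj_mem_map_conj T w (Subgroup.mem_inf.1 ht).2⟩,
    w * u * w⁻¹, Subgroup.mem_inf.2 ⟨hw u (Subgroup.mem_inf.1 hu).1, conj_mem_map_conj U w (Subgroup.mem_inf.1 hu).2⟩, ?_⟩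
  calc k = w * (w⁻¹ * k * w) * w⁻¹ := by group
    _ = w * (v * t * u) * w⁻¹ := by rw [hvtu]
    _ = w * v * w⁻¹ * (w * t * w⁻¹) * (w * u * w⁻¹) := by group

/-- **TRANSPORT OF LEMMA 54 `h54`**: if `u a′ ∈ Ω k ⇒ u ∈ Ω 2k` on `U × A`, `w` normalises every `Ω k` and `w⁻¹ A w ⊆ A`, then the same holds on `wUw⁻¹ × A`.
[cite: HarishChandra1970, Part VII §8 Lemma 54 p. 82] -/
theorem lemma54_map_conj (Ω : ℕ → Set G) (U A : Subgroup G) (w : G)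
    (hwΩ : ∀ (n : ℕ) (g : G), g ∈ Ω n → w * g * w⁻¹ ∈ Ω n) (hwΩ' : ∀ (n : ℕ) (g : G), g ∈ Ω n → w⁻¹ * g * w ∈ Ω n) (hwA' : ∀ a ∈ A, w⁻¹ * a * w ∈ A)
    (h54 : ∀ u ∈ U, ∀ a' ∈ A, ∀ k : ℕ, u * a' ∈ Ω k → u ∈ Ω (2 * k)) :
    ∀ u ∈ U.map (MulAut.conj w).toMonoidHom, ∀ a' ∈ A, ∀ k : ℕ, u * a' ∈ Ω k → u ∈ Ω (2 * k) := by
  intro u hu a' ha' k huak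
  have h1 : w⁻¹ * u * w * (w⁻¹ * a' * w) ∈ Ω k := by
    have e : w⁻¹ * u * w * (w⁻¹ * a' * w) = w⁻¹ * (u * a') * w := by group
    rw [e]; exact hwΩ' k _ huak
  have h2 := h54 _ (mem_of_mem_map_conj U w hu) _ (hwA' a' ha') k h1
  have e : w * (w⁻¹ * u * w) * w⁻¹ = u := by group
  simpa only [e] using hwΩ (2 * k) _ h2

/-- **TRANSPORT OF `hV`** (the piece conjugates `K₀ ∩ V` into `K₀`): with `P′ := {a : w⁻¹ a w ∈ P}` and `V′ := wVw⁻¹`. [cite: HarishChandra1970, Part VII §8 Lemma 55 p. 82] -/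
theorem conjV_map_conj (K₀ V : Subgroup G) (P : Set G) (w : G) (hw : ∀ k ∈ K₀, w * k * w⁻¹ ∈ K₀) (hw' : ∀ k ∈ K₀, w⁻¹ * k * w ∈ K₀)
    (hV : ∀ a ∈ P, ∀ v ∈ K₀ ⊓ V, a * v * a⁻¹ ∈ K₀) :
    ∀ a ∈ {a : G | w⁻¹ * a * w ∈ P}, ∀ v ∈ K₀ ⊓ V.map (MulAut.conj w).toMonoidHom, a * v * a⁻¹ ∈ K₀ := by
  intro a ha v hv
  obtain ⟨hvK, hvV⟩ := (mem_inf_map_conj_iff' K₀ V w v).1 hv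
  have h1 := hV _ ha (w⁻¹ * v * w) (Subgroup.mem_inf.2 ⟨hw' v hvK, hvV⟩)
  have h2 := hw _ h1
  have e : w * (w⁻¹ * a * w * (w⁻¹ * v * w) * (w⁻¹ * a * w)⁻¹) * w⁻¹ = a * v * a⁻¹ := by group
  rwa [e] at h2

/-- **TRANSPORT OF THE LEVI DEFECT `hT`** (`a (K₀ ∩ T) a⁻¹ ⊆ Ω D`): with `P′ := {a : w⁻¹ a w ∈ P}`, `T′ := wTw⁻¹`. [cite: HarishChandra1970, Part VII §8 p. 82] -/
theorem conjT_map_conj (Ω : ℕ → Set G) (K₀ T : Subgroup G) (P : Set G) (D : ℕ) (w : G)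
    (hwΩ : ∀ (n : ℕ) (g : G), g ∈ Ω n → w * g * w⁻¹ ∈ Ω n) (hw' : ∀ k ∈ K₀, w⁻¹ * k * w ∈ K₀)
    (hT : ∀ a ∈ P, ∀ t ∈ K₀ ⊓ T, a * t * a⁻¹ ∈ Ω D) :
    ∀ a ∈ {a : G | w⁻¹ * a * w ∈ P}, ∀ t ∈ K₀ ⊓ T.map (MulAut.conj w).toMonoidHom, a * t * a⁻¹ ∈ Ω D := by
  intro a ha t ht
  obtain ⟨htK, htT⟩ := (mem_inf_map_conj_iff' K₀ T w t).1 ht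
  have h1 := hT _ ha (w⁻¹ * t * w) (Subgroup.mem_inf.2 ⟨hw' t htK, htT⟩)
  have h2 := hwΩ D _ h1
  have e : w * (w⁻¹ * a * w * (w⁻¹ * t * w) * (w⁻¹ * a * w)⁻¹) * w⁻¹ = a * t * a⁻¹ := by group
  rwa [e] at h2

/-- **TRANSPORT OF `hnormU`** (the piece normalises `U`). [cite: HarishChandra1970, Part VII §8 p. 82] -/
theorem normU_map_conj (U : Subgroup G) (P : Set G) (w : G) (hnormU : ∀ a ∈ P, ∀ u ∈ U, a * u * a⁻¹ ∈ U) :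
    ∀ a ∈ {a : G | w⁻¹ * a * w ∈ P}, ∀ u ∈ U.map (MulAut.conj w).toMonoidHom, a * u * a⁻¹ ∈ U.map (MulAut.conj w).toMonoidHom := by
  intro a ha u hu
  have h1 := hnormU _ ha (w⁻¹ * u * w) (mem_of_mem_map_conj U w hu)
  rw [Subgroup.mem_map_equiv, MulAut.conj_symm_apply]
  have e : w⁻¹ * (a * u * a⁻¹) * w = w⁻¹ * a * w * (w⁻¹ * u * w) * (w⁻¹ * a * w)⁻¹ := by group
  rwa [e]

/-- **TRANSPORT OF THE CONTRACTION `hcontr`** (`a⁻¹ (U ∩ Ω k) a ⊆ L j` for `j + k ≤ B`): `w` normalises every `Ω k` and every `L j`.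
[cite: HarishChandra1970, Part VII §8 Lemma 55 p. 82] [cite: Casselman1995, Prop. 1.4.3] -/
theorem contr_map_conj (Ω : ℕ → Set G) (U : Subgroup G) (P : Set G) (L : ℕ → Subgroup G) (B : ℕ) (w : G)
    (hwΩ' : ∀ (n : ℕ) (g : G), g ∈ Ω n → w⁻¹ * g * w ∈ Ω n) (hwL : ∀ (j : ℕ), ∀ g ∈ L j, w * g * w⁻¹ ∈ L j)
    (hcontr : ∀ a ∈ P, ∀ (k j : ℕ), j + k ≤ B → ∀ u ∈ U, u ∈ Ω k → a⁻¹ * u * a ∈ L j) :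
    ∀ a ∈ {a : G | w⁻¹ * a * w ∈ P}, ∀ (k j : ℕ), j + k ≤ B → ∀ u ∈ U.map (MulAut.conj w).toMonoidHom, u ∈ Ω k → a⁻¹ * u * a ∈ L j := by
  intro a ha k j hkj u hu huk
  have h1 := hcontr _ ha k j hkj (w⁻¹ * u * w) (mem_of_mem_map_conj U w hu) (hwΩ' k u huk)
  have h2 := hwL j _ h1
  have e : w * ((w⁻¹ * a * w)⁻¹ * (w⁻¹ * u * w) * (w⁻¹ * a * w)) * w⁻¹ = a⁻¹ * u * a := by group
  rwa [e] at h2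

end Algebra

/-! ## §2 Closedness and the cusp-form property along a conjugated subgroup -/

section Topology

variable {G : Type*} [Group G] [TopologicalSpace G] [IsTopologicalGroup G]

/-- `wUw⁻¹` is closed when `U` is (image under the homeomorphism `g ↦ w g w⁻¹`). [folklore] -/
theorem isClosed_map_conj (U : Subgroup G) (hU : IsClosed (U : Set G)) (w : G) : IsClosed ((U.map (MulAut.conj w).toMonoidHom : Subgroup G) : Set G) := by
  have himg : ((U.map (MulAut.conj w).toMonoidHom : Subgroup G) : Set G) = ((Homeomorph.mulLeft w).trans (Homeomorph.mulRight w⁻¹)) '' (U : Set G) := by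
    rw [Subgroup.coe_map]
    rfl
  rw [himg]
  exact (Homeomorph.isClosed_image _).2 hU

variable [MeasurableSpace G] [BorelSpace G] {E : Type*} [NormedAddCommGroup E] [NormedSpace ℝ E]

/-- **THE CUSP-FORM PROPERTY ALONG `wUw⁻¹`, HONEST FORM.**  If `∫_U f(x · w u w⁻¹) dν₀(u) = 0` for every Haar measure `ν₀` of `U` and every `x`, then
`∫_{wUw⁻¹} f(x v) dν(v) = 0` for every Haar measure `ν` of `wUw⁻¹` and every `x`: transport along the isomorphism of topological groups `u ↦ w u w⁻¹`,
`U ≃ₜ* wUw⁻¹` (pulling `ν` back gives a Haar measure of `U`).  NOTE: a ONE-SIDED cusp form along `U` (`∫_U f(x u) du = 0`) is not formally one along `wUw⁻¹`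
(`x (w u w⁻¹) = (x w) u w⁻¹` has `w⁻¹` on the right); the hypothesis is exactly what is needed and is what ★ B4-E1∕B4-A1 supply at `GL₃` (the slice of `w⁻¹ γ w`).
[cite: HarishChandra1970, Part I §3 p. 9; Part VII §8 p. 81] [cite: Folland1995, §2.4] -/
theorem integral_map_conj_eq_zero_of_forall_haar (U : Subgroup G) (w : G) (f : G → E)
    (h : ∀ ν₀ : Measure ↥U, ν₀.IsHaarMeasure → ∀ x : G, ∫ u : ↥U, f (x * (w * ↑u * w⁻¹)) ∂ν₀ = 0)
    (ν : Measure ↥(U.map (MulAut.conj w).toMonoidHom)) [ν.IsHaarMeasure] (x : G) :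
    ∫ v : ↥(U.map (MulAut.conj w).toMonoidHom), f (x * ↑v) ∂ν = 0 := by
  -- the conjugation isomorphism of topological groups `U ≃ₜ* wUw⁻¹`
  obtain ⟨e, he⟩ : ∃ e : ↥U ≃ₜ* ↥(U.map (MulAut.conj w).toMonoidHom), ∀ u : ↥U, ((e u : ↥(U.map (MulAut.conj w).toMonoidHom)) : G) = w * ↑u * w⁻¹ :=
    ⟨{ toFun := fun u => ⟨w * ↑u * w⁻¹, conj_mem_map_conj U w u.2⟩
       invFun := fun v => ⟨w⁻¹ * ↑v * w, mem_of_mem_map_conj U w v.2⟩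
       left_inv := fun u => Subtype.ext (by simp only; group)
       right_inv := fun v => Subtype.ext (by simp only; group)
       map_mul' := fun u v => Subtype.ext (by simp only [Subgroup.coe_mul]; group)
       continuous_toFun := by
         refine Continuous.subtype_mk ?_ _
         exact ((continuous_const.mul continuous_subtype_val).mul continuous_const)
       continuous_invFun := by
         refine Continuous.subtype_mk ?_ _
         exact ((continuous_const.mul continuous_subtype_val).mul continuous_const) }, fun _ => rfl⟩
  haveI : (ν.map e.symm).IsHaarMeasure := e.symm.isHaarMeasure_map ν
  have hme : Measurable (e : ↥U → ↥(U.map (MulAut.conj w).toMonoidHom)) := e.continuous.measurable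
  have hms : Measurable (e.symm : ↥(U.map (MulAut.conj w).toMonoidHom) → ↥U) := e.symm.continuous.measurable
  have hmap : (ν.map e.symm).map e = ν := by
    rw [Measure.map_map hme hms]
    have hid : ((e : ↥U → ↥(U.map (MulAut.conj w).toMonoidHom)) ∘ (e.symm : ↥(U.map (MulAut.conj w).toMonoidHom) → ↥U)) = id :=
      funext fun v => e.apply_symm_apply v
    rw [hid, Measure.map_id]
  calc ∫ v : ↥(U.map (MulAut.conj w).toMonoidHom), f (x * ↑v) ∂ν
      = ∫ v : ↥(U.map (MulAut.conj w).toMonoidHom), f (x * ↑v) ∂((ν.map e.symm).map e) := by rw [hmap]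
    _ = ∫ u : ↥U, f (x * ↑(e u)) ∂(ν.map e.symm) := e.toHomeomorph.measurableEmbedding.integral_map _
    _ = ∫ u : ↥U, f (x * (w * ↑u * w⁻¹)) ∂(ν.map e.symm) := by simp only [he]
    _ = 0 := h _ inferInstance x

end Topology

/-! ## §3 ★ (A) for the transported family `W × ι` (chambers × regimes) -/

section Measure

variable {G : Type*} [Group G] [TopologicalSpace G] [IsTopologicalGroup G] [MeasurableSpace G] [BorelSpace G]
  [SecondCountableTopology G] [LocallyCompactSpace G]
  {E : Type*} [NormedAddCommGroup E] [NormedSpace ℝ E]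

/-- **THEOREM 20 AT THE CONJUGATE LEVEL FOR THE TRANSPORTED FAMILY** `(ω, c) ↦ (w_ω T_c w_ω⁻¹, w_ω U_c w_ω⁻¹, w_ω V_c w_ω⁻¹, {a : w_ω⁻¹ a w_ω ∈ P_c}, D_c)`.
Data: height balls `Ω` (submultiplicative, symmetric), level `K₀ ⊆ Ω 0`, conjugate level `K′ = {k ∈ K₀ : y k y⁻¹ ∈ K₀}` (compact open) for `y ∈ Ω s`, deep levels
`L j` with `L (m + 2s) ⊆ K′`, torus `A`, BASE directions `c : ι ↦ (T_c, U_c, V_c, P_c, D_c)` with the six structural hypotheses of ★ (A) (`hIw`, `h54`, `hV`, `hT`,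
`hnormU`, `hcontr`), `U_c` closed; conjugators `w : W → G` normalising `K₀`, every `Ω k`, every `L j`, with `w⁻¹ A w ⊆ A`; a continuous `f` with `supp f ⊆ C·A`,
`C ⊆ Ω m_C`, such that `∫_{U_c} f(x · w_ω u w_ω⁻¹) du = 0` for all `ω, c, x` and every Haar measure of `U_c`; the cover `a ∈ A`, `a ∉ Ω R ⇒ ∃ ω c, w_ω⁻¹ a w_ω ∈ P_c`.
Conclusion: for `x ∉ Ω (m_C + R + s)`, **`∫_{k ∈ K′} f(x y k) dμ(k) = 0`** (`μ` a left Haar measure).  Proof: §1–§2 feed ★ (A)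
`cuspForm_cancellation_polychotomy_conjLevel` over `W × ι` with the Haar measures of the closed subgroups `w_ω U_c w_ω⁻¹`.
[cite: HarishChandra1970, Part VII §2 Theorem 20 p. 70; §8 pp. 80–84 (`P = P_F`, `a ∈ A_F^+`, `s ∈ W`)] [cite: Casselman1995, Prop. 1.4.3–1.4.4] -/
theorem cuspForm_cancellation_polychotomy_conjLevel_of_base {ι W : Type*} (μ : Measure G) [μ.IsHaarMeasure] (Ω : ℕ → Set G)
    (hΩmul : ∀ {a b : ℕ} {g g' : G}, g ∈ Ω a → g' ∈ Ω b → g * g' ∈ Ω (a + b)) (hΩinv : ∀ {a : ℕ} {g : G}, g ∈ Ω a → g⁻¹ ∈ Ω a)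
    (K₀ K' A : Subgroup G) (T U V : ι → Subgroup G) (P : ι → Set G) (D : ι → ℕ) (L : ℕ → Subgroup G) (w : W → G)
    (hwK₀ : ∀ ω, ∀ k ∈ K₀, w ω * k * (w ω)⁻¹ ∈ K₀) (hwK₀' : ∀ ω, ∀ k ∈ K₀, (w ω)⁻¹ * k * w ω ∈ K₀)
    (hwΩ : ∀ ω (n : ℕ) (g : G), g ∈ Ω n → w ω * g * (w ω)⁻¹ ∈ Ω n) (hwΩ' : ∀ ω (n : ℕ) (g : G), g ∈ Ω n → (w ω)⁻¹ * g * w ω ∈ Ω n)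
    (hwL : ∀ ω (j : ℕ), ∀ g ∈ L j, w ω * g * (w ω)⁻¹ ∈ L j) (hwA' : ∀ ω, ∀ a ∈ A, (w ω)⁻¹ * a * w ω ∈ A)
    (hK₀ : (K₀ : Set G) ⊆ Ω 0) {m s : ℕ} {y : G} (hy : y ∈ Ω s)
    (hK' : ∀ k, k ∈ K' ↔ k ∈ K₀ ∧ y * k * y⁻¹ ∈ K₀) (hdeep : ∀ u ∈ L (m + 2 * s), u ∈ K₀ ∧ y * u * y⁻¹ ∈ K₀)
    (hK'o : IsOpen (K' : Set G)) (hK'c : IsCompact (K' : Set G)) (hU : ∀ c, IsClosed ((U c : Subgroup G) : Set G))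
    (f : G → E) (hf : Continuous f) (C : Set G) {mC : ℕ} (hC : C ⊆ Ω mC) (hsupp : ∀ g, f g ≠ 0 → g ∈ C * (A : Set G))
    (hcusp : ∀ ω c, ∀ ν₀ : Measure ↥(U c), ν₀.IsHaarMeasure → ∀ x : G, ∫ u : ↥(U c), f (x * (w ω * ↑u * (w ω)⁻¹)) ∂ν₀ = 0) {R : ℕ}
    (hcover : ∀ a ∈ A, a ∉ Ω R → ∃ ω c, (w ω)⁻¹ * a * w ω ∈ P c)
    (hIw : ∀ c, ∀ k ∈ K₀, ∃ v ∈ K₀ ⊓ V c, ∃ t ∈ K₀ ⊓ T c, ∃ u ∈ K₀ ⊓ U c, k = v * t * u)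
    (h54 : ∀ c, ∀ u ∈ U c, ∀ a' ∈ A, ∀ k : ℕ, u * a' ∈ Ω k → u ∈ Ω (2 * k))
    (hV : ∀ c, ∀ a ∈ P c, ∀ v ∈ K₀ ⊓ V c, a * v * a⁻¹ ∈ K₀)
    (hT : ∀ c, ∀ a ∈ P c, ∀ t ∈ K₀ ⊓ T c, a * t * a⁻¹ ∈ Ω (D c))
    (hnormU : ∀ c, ∀ a ∈ P c, ∀ u ∈ U c, a * u * a⁻¹ ∈ U c)
    (hcontr : ∀ c, ∀ a ∈ P c, ∀ (k j : ℕ), j + k ≤ m + 2 * s + (4 * mC + 2 * D c) + 1 → ∀ u ∈ U c, u ∈ Ω k → a⁻¹ * u * a ∈ L j)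
    {x : G} (hx : x ∉ Ω (mC + R + s)) :
    ∫ k in (K' : Set G), f (x * y * k) ∂μ = 0 := by
  -- the transported family, indexed by `W × ι`
  set T' : W × ι → Subgroup G := fun p => (T p.2).map (MulAut.conj (w p.1)).toMonoidHom with hT'
  set U' : W × ι → Subgroup G := fun p => (U p.2).map (MulAut.conj (w p.1)).toMonoidHom with hU'
  set V' : W × ι → Subgroup G := fun p => (V p.2).map (MulAut.conj (w p.1)).toMonoidHom with hV'
  set P' : W × ι → Set G := fun p => {a : G | (w p.1)⁻¹ * a * w p.1 ∈ P p.2} with hP'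
  set D' : W × ι → ℕ := fun p => D p.2 with hD'
  have hU'c : ∀ p, IsClosed ((U' p : Subgroup G) : Set G) := fun p => isClosed_map_conj (U p.2) (hU p.2) (w p.1)
  -- Haar measures on the closed subgroups `w U_c w⁻¹`
  have hlc : ∀ p, LocallyCompactSpace ↥(U' p) := fun p => (hU'c p).isClosedEmbedding_subtypeVal.locallyCompactSpace
  set ν : (p : W × ι) → Measure ↥(U' p) := fun p => Measure.haar with hν
  haveI hνH : ∀ p, (ν p).IsHaarMeasure := fun p => by rw [hν]; infer_instance
  have hsc : ∀ p, SecondCountableTopology ↥(U' p) := fun p => TopologicalSpace.Subtype.secondCountableTopology _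
  haveI : ∀ p, SigmaCompactSpace ↥(U' p) := fun p => @sigmaCompactSpace_of_locallyCompact_secondCountable _ _ (hlc p) (hsc p)
  haveI : ∀ p, SFinite (ν p) := fun p => inferInstance
  haveI : ∀ p, (ν p).IsOpenPosMeasure := fun p => inferInstance
  haveI : ∀ p, IsFiniteMeasureOnCompacts (ν p) := fun p => inferInstance
  haveI : ∀ p, (ν p).IsMulLeftInvariant := fun p => inferInstance
  have hcusp' : ∀ p, ∀ z : G, ∫ u : ↥(U' p), f (z * ↑u) ∂(ν p) = 0 := fun p z =>
    integral_map_conj_eq_zero_of_forall_haar (U p.2) (w p.1) f (hcusp p.1 p.2) (ν p) z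
  refine cuspForm_cancellation_polychotomy_conjLevel μ Ω hΩmul hΩinv K₀ K' A T' U' V' P' D' L ν hK₀ hy hK' hdeep hK'o hK'c hU'c f hf C hC hsupp hcusp'
    (R := R) (fun a ha haR => ?_) (fun p => ?_) (fun p => ?_) (fun p => ?_) (fun p => ?_) (fun p => ?_) (fun p => ?_) hx
  · obtain ⟨ω, c, h⟩ := hcover a ha haR
    exact ⟨(ω, c), h⟩
  · exact iwahori_map_conj K₀ (T p.2) (U p.2) (V p.2) (w p.1) (hwK₀ p.1) (hwK₀' p.1) (hIw p.2)
  · exact lemma54_map_conj Ω (U p.2) A (w p.1) (hwΩ p.1) (hwΩ' p.1) (hwA' p.1) (h54 p.2)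
  · exact conjV_map_conj K₀ (V p.2) (P p.2) (w p.1) (hwK₀ p.1) (hwK₀' p.1) (hV p.2)
  · exact conjT_map_conj Ω K₀ (T p.2) (P p.2) (D p.2) (w p.1) (hwΩ p.1) (hwK₀' p.1) (hT p.2)
  · exact normU_map_conj (U p.2) (P p.2) (w p.1) (hnormU p.2)
  · exact contr_map_conj Ω (U p.2) (P p.2) L _ (w p.1) (hwΩ' p.1) (hwL p.1) (hcontr p.2)

end Measure

/-! ## §4 From the conjugate level `K₀(y⁻¹)` to any compact open level `K₁ ⊇ K₀` inside `Ω 0` (print, p. 71) -/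

section LevelOne

variable {G : Type*} [Group G] [TopologicalSpace G] [IsTopologicalGroup G] [MeasurableSpace G] [BorelSpace G]
  [SecondCountableTopology G] [LocallyCompactSpace G]
  {E : Type*} [NormedAddCommGroup E] [NormedSpace ℝ E]

/-- **THE LEVEL-ONE UPGRADE, GENERIC.**  `Ω` submultiplicative and symmetric, `K₀ ≤ K₁ ⊆ Ω 0` with `K₁` compact open and `K₀` open, `μ` a left AND right invariant
Haar measure, `f` continuous.  If Theorem 20 holds at the conjugate level `K₀(y⁻¹) = K₀ ⊓ y⁻¹K₀y` — `∀ x ∉ Ω R, ∫_{k ∈ K₀(y⁻¹)} f(x y k) dμ = 0` — then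
**`∀ x ∉ Ω R, ∫_{k ∈ K₁} f(x k y) dμ = 0`**.  Print: `∫_{K₀(y)} f(xky) dk = ∫_{K₀(y⁻¹)} f(xyk) dk` (★ `setIntegral_conj_comm`, unimodularity), and «`∫_{K₁} f(x k y₀) dk = 0`
… where `k` runs over representatives of `K₁/K₀(y₀)`; now `σ(xk) = σ(x)`» (★ averaging `setIntegral_eq_zero_of_forall_setIntegral_sublevel_eq_zero`; `x k ∉ Ω R` for
`k ∈ K₁ ⊆ Ω 0`). [cite: HarishChandra1970, Part VII §3 p. 71; §8 p. 81] [cite: Folland1995, §2.4] -/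
theorem setIntegral_level_eq_zero_of_conjLevel (μ : Measure G) [μ.IsHaarMeasure] [μ.IsMulRightInvariant] (Ω : ℕ → Set G)
    (hΩmul : ∀ {a b : ℕ} {g g' : G}, g ∈ Ω a → g' ∈ Ω b → g * g' ∈ Ω (a + b)) (hΩinv : ∀ {a : ℕ} {g : G}, g ∈ Ω a → g⁻¹ ∈ Ω a)
    (K₁ K₀ : Subgroup G) (hK₁ : (K₁ : Set G) ⊆ Ω 0) (hK₀K₁ : K₀ ≤ K₁) (hK₁o : IsOpen (K₁ : Set G)) (hK₁c : IsCompact (K₁ : Set G))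
    (hK₀o : IsOpen (K₀ : Set G)) (f : G → E) (hf : Continuous f) {R : ℕ} (y : G)
    (h20 : ∀ x : G, x ∉ Ω R → ∫ k in ((K₀ ⊓ K₀.map (MulAut.conj y⁻¹).toMonoidHom : Subgroup G) : Set G), f (x * y * k) ∂μ = 0)
    {x : G} (hx : x ∉ Ω R) :
    ∫ k in (K₁ : Set G), f (x * k * y) ∂μ = 0 := by
  refine setIntegral_eq_zero_of_forall_setIntegral_sublevel_eq_zero μ K₁ (K₀ ⊓ K₀.map (MulAut.conj y).toMonoidHom)
    (fun k hk => hK₀K₁ (Subgroup.mem_inf.1 hk).1) (isOpen_inf_map_conj K₀ hK₀o y) hK₁o hK₁c (fun k => f (x * k * y))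
    (hf.comp ((continuous_const.mul continuous_id).mul continuous_const)) fun k hk => ?_
  -- for `k ∈ K₁ ⊆ Ω 0`, `x k ∉ Ω R`
  have hxk : x * k ∉ Ω R := by
    intro hxk
    apply hx
    have h1 := hΩmul hxk (hΩinv (hK₁ hk))
    rwa [add_zero, mul_inv_cancel_right] at h1
  -- print's first line: `∫_{K₀(y)} F(k′ y) dk′ = ∫_{K₀(y⁻¹)} F(y k′) dk′`
  have hset : {k' : G | y * k' * y⁻¹ ∈ ((K₀ ⊓ K₀.map (MulAut.conj y).toMonoidHom : Subgroup G) : Set G)} =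
      ((K₀ ⊓ K₀.map (MulAut.conj y⁻¹).toMonoidHom : Subgroup G) : Set G) := by
    ext k'
    simp only [mem_setOf_eq, SetLike.mem_coe, mem_inf_map_conj_iff, inv_inv]
    have e : y⁻¹ * (y * k' * y⁻¹) * y = k' := by group
    rw [e]
    exact and_comm
  have h := setIntegral_conj_comm μ f (((K₀ ⊓ K₀.map (MulAut.conj y).toMonoidHom : Subgroup G) : Set G)) (x * k) y
  have h' : ∫ k' in ((K₀ ⊓ K₀.map (MulAut.conj y).toMonoidHom : Subgroup G) : Set G), f (x * k * k' * y) ∂μ =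
      ∫ k' in ((K₀ ⊓ K₀.map (MulAut.conj y⁻¹).toMonoidHom : Subgroup G) : Set G), f (x * k * y * k') ∂μ := by
    rw [← hset]; exact h
  have h'' : (fun k' => f (x * k * k' * y)) = fun k' => f (x * (k * k') * y) := by
    funext k'; simp only [mul_assoc]
  rw [← h'', h']
  exact h20 (x * k) hxk

/-- **THEOREM 20 ON A FULL LEVEL `K₁` FOR THE TRANSPORTED FAMILY** (§3 ∘ §4): under the data of `cuspForm_cancellation_polychotomy_conjLevel_of_base` with the deep
containment in the form `∀ u ∈ L (m+2s), u ∈ K₀ ∧ y u y⁻¹ ∈ K₀` for the given `y ∈ Ω s`, a compact open level `K₁` with `K₀ ≤ K₁ ⊆ Ω 0`, `K₀` open and compact, and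
`μ` left and right invariant: for `x ∉ Ω (m_C + R + s)`, **`∫_{k ∈ K₁} f(x k y) dμ(k) = 0`**. [cite: HarishChandra1970, Part VII §2 Theorem 20 p. 70; §3 p. 71] -/
theorem cuspForm_cancellation_polychotomy_levelOne_of_base {ι W : Type*} (μ : Measure G) [μ.IsHaarMeasure] [μ.IsMulRightInvariant] (Ω : ℕ → Set G)
    (hΩmul : ∀ {a b : ℕ} {g g' : G}, g ∈ Ω a → g' ∈ Ω b → g * g' ∈ Ω (a + b)) (hΩinv : ∀ {a : ℕ} {g : G}, g ∈ Ω a → g⁻¹ ∈ Ω a)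
    (K₁ K₀ A : Subgroup G) (T U V : ι → Subgroup G) (P : ι → Set G) (D : ι → ℕ) (L : ℕ → Subgroup G) (w : W → G)
    (hwK₀ : ∀ ω, ∀ k ∈ K₀, w ω * k * (w ω)⁻¹ ∈ K₀) (hwK₀' : ∀ ω, ∀ k ∈ K₀, (w ω)⁻¹ * k * w ω ∈ K₀)
    (hwΩ : ∀ ω (n : ℕ) (g : G), g ∈ Ω n → w ω * g * (w ω)⁻¹ ∈ Ω n) (hwΩ' : ∀ ω (n : ℕ) (g : G), g ∈ Ω n → (w ω)⁻¹ * g * w ω ∈ Ω n)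
    (hwL : ∀ ω (j : ℕ), ∀ g ∈ L j, w ω * g * (w ω)⁻¹ ∈ L j) (hwA' : ∀ ω, ∀ a ∈ A, (w ω)⁻¹ * a * w ω ∈ A)
    (hK₁ : (K₁ : Set G) ⊆ Ω 0) (hK₀K₁ : K₀ ≤ K₁) (hK₁o : IsOpen (K₁ : Set G)) (hK₁c : IsCompact (K₁ : Set G))
    (hK₀o : IsOpen (K₀ : Set G)) (hK₀c : IsCompact (K₀ : Set G)) {m s : ℕ} {y : G} (hy : y ∈ Ω s)
    (hdeep : ∀ u ∈ L (m + 2 * s), u ∈ K₀ ∧ y * u * y⁻¹ ∈ K₀) (hU : ∀ c, IsClosed ((U c : Subgroup G) : Set G))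
    (f : G → E) (hf : Continuous f) (C : Set G) {mC : ℕ} (hC : C ⊆ Ω mC) (hsupp : ∀ g, f g ≠ 0 → g ∈ C * (A : Set G))
    (hcusp : ∀ ω c, ∀ ν₀ : Measure ↥(U c), ν₀.IsHaarMeasure → ∀ x : G, ∫ u : ↥(U c), f (x * (w ω * ↑u * (w ω)⁻¹)) ∂ν₀ = 0) {R : ℕ}
    (hcover : ∀ a ∈ A, a ∉ Ω R → ∃ ω c, (w ω)⁻¹ * a * w ω ∈ P c)
    (hIw : ∀ c, ∀ k ∈ K₀, ∃ v ∈ K₀ ⊓ V c, ∃ t ∈ K₀ ⊓ T c, ∃ u ∈ K₀ ⊓ U c, k = v * t * u)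
    (h54 : ∀ c, ∀ u ∈ U c, ∀ a' ∈ A, ∀ k : ℕ, u * a' ∈ Ω k → u ∈ Ω (2 * k))
    (hV : ∀ c, ∀ a ∈ P c, ∀ v ∈ K₀ ⊓ V c, a * v * a⁻¹ ∈ K₀)
    (hT : ∀ c, ∀ a ∈ P c, ∀ t ∈ K₀ ⊓ T c, a * t * a⁻¹ ∈ Ω (D c))
    (hnormU : ∀ c, ∀ a ∈ P c, ∀ u ∈ U c, a * u * a⁻¹ ∈ U c)
    (hcontr : ∀ c, ∀ a ∈ P c, ∀ (k j : ℕ), j + k ≤ m + 2 * s + (4 * mC + 2 * D c) + 1 → ∀ u ∈ U c, u ∈ Ω k → a⁻¹ * u * a ∈ L j)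
    {x : G} (hx : x ∉ Ω (mC + R + s)) :
    ∫ k in (K₁ : Set G), f (x * k * y) ∂μ = 0 := by
  have hK₀ : (K₀ : Set G) ⊆ Ω 0 := fun k hk => hK₁ (hK₀K₁ hk)
  -- the conjugate level `K′ = K₀(y⁻¹)`
  have hK'mem : ∀ k, k ∈ K₀ ⊓ K₀.map (MulAut.conj y⁻¹).toMonoidHom ↔ k ∈ K₀ ∧ y * k * y⁻¹ ∈ K₀ := by
    intro k
    rw [mem_inf_map_conj_iff, inv_inv]
  have hK'o : IsOpen ((K₀ ⊓ K₀.map (MulAut.conj y⁻¹).toMonoidHom : Subgroup G) : Set G) := isOpen_inf_map_conj K₀ hK₀o y⁻¹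
  have hK'c : IsCompact ((K₀ ⊓ K₀.map (MulAut.conj y⁻¹).toMonoidHom : Subgroup G) : Set G) :=
    hK₀c.of_isClosed_subset ((K₀ ⊓ K₀.map (MulAut.conj y⁻¹).toMonoidHom).isClosed_of_isOpen hK'o) fun k hk => ((hK'mem k).1 hk).1
  exact setIntegral_level_eq_zero_of_conjLevel μ Ω hΩmul hΩinv K₁ K₀ hK₁ hK₀K₁ hK₁o hK₁c hK₀o f hf y
    (fun x' hx' => cuspForm_cancellation_polychotomy_conjLevel_of_base μ Ω hΩmul hΩinv K₀ _ A T U V P D L w hwK₀ hwK₀' hwΩ hwΩ' hwL hwA' hK₀ hy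
      hK'mem hdeep hK'o hK'c hU f hf C hC hsupp hcusp hcover hIw h54 hV hT hnormU hcontr hx') hx

end LevelOne

end Summit.HodgeConjecture.HodgeConjecture.Cruxes.H413.K2E3CuspFormCancellationPolychotomyTransport

end
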